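import Literature.NumberTheory.EllipticCurves.BigRepModuleShapiroInjectiveProofs
import HarnessLib

/-!
# Shapiro's lemma for the co-induced module `M = A ⊗ Λ^*(Ψ⁻¹)`, SURJECTIVITY half, cocycle level —
# every continuous 1-cocycle of `(ker κ, ρ)` is the evaluation-at-`0` of an explicit continuous
# 1-cocycle of `bigRep κ ρ`, GIVEN a continuous homomorphic section of `κ` — PROVED

Topic `Literature/NumberTheory/EllipticCurves`. Theorems only: no definition, no named fact, no
`sorry`, no instance, no notation. Cell `bsd-stepL`, seat `bsd-stepL-imc-p1` (g11): module M2a of the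
tree-mapped discharge plan `NOTE-prop323-Shapiro-discharge-plan-imc-p1-g11` (HOME/imc-p1/g11/) for the
named fact `SkinnerUrban2014.prop323_XAc_equiv_XBigDecomp` ([SU14] Prop. 3.2.3, Shapiro's lemma for
Selmer groups), sequel of `BigRepModuleShapiroInjectiveProofs.lean` (M1, injectivity).

## What is proved (generic: any topological group `G`, `κ : G → ℤ_p` with a continuous homomorphic SECTION `σ`,
## `ρ` continuous on a discrete `p`-primary `A`, `H = ker κ`)

**`exists_cocycle_apply_zero_eq`** — for every continuous 1-cocycle `z : H → A` of `ρ|_H` there is a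
continuous 1-cocycle `c : G → M` of `bigRep κ ρ` with `c(h)(0) = z(h)` for all `h ∈ H` (EXACT equality,
not only up to a coboundary). The lift is the classical inverse Shapiro map written with the section:

  `c(g)(x) = ρ(σ x) · z(σ(x)⁻¹ · g · σ(x − κ g))`,   the argument lying in `H = ker κ`,

* cocycle identity: `σ(x)⁻¹ (g h) σ(x − κ g − κ h) = [σ(x)⁻¹ g σ(x − κ g)] · [σ(x − κ g)⁻¹ h σ(x − κ g − κ h)]`
  and `z(uv) = z(u) + ρ(u) z(v)`, `ρ(σ x) ρ(u) = ρ(g) ρ(σ(x − κ g))`;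
* `c(g) ∈ M`: `x ↦ c(g)(x)` is continuous (`A` discrete) hence smooth of some level
  (`exists_isSmoothOfLevel_of_continuous`, M1) and uniformly `p`-primary (`exists_uniform_pow_smul_eq_zero`);
* `c` is continuous into the DISCRETE `M`: `(g, x) ↦ c(g)(x)` is jointly continuous and `ℤ_p` is compact
  (tube lemma, `IsCompact.eventually_forall_of_forall_eventually`);
* `c(h)(0) = z(h)`: `σ(0) = 1`.
* `exists_cocycle_apply_zero_eq_of_section` — the SAME lift for a continuous section `s` OF SETS with `s 0 = 1`
  (the homomorphy of the section is never used).
With M1 this gives: Shapiro's map `[c] ↦ [h ↦ c(h)(0)]`, `H¹(G, M) → H¹(H, A)`, is BIJECTIVE whenever `κ`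
admits a continuous (set-theoretic) section (for `G = Γ_K` and `κ` a `ℤ_p`-extension such a section exists —
the `ℤ_p`-analogue of the tree's `Literature.GroupTheory.FreeProcyclicQuotientRetraction` for free
procyclic quotients — and is module M2b of the plan; NOT proved here).

HONEST FRAMING: group cohomology of an induced module; nothing about elliptic curves, Selmer groups
or BSD; the named fact `prop323_…` is NOT discharged by this file.

References: [SkinnerUrban2014] §3.1.1–3.1.2, Prop. 3.2.3 and its proof (pp. 16–18, 21–22);
[SerreGaloisCohomology1997] I §2.5 (induced modules, Shapiro's lemma) and I §5.8;
[NeukirchSchmidtWingberg2008] (1.6.4). Tree: `AnticyclotomicBigGaloisRep.lean` (`BigRepModule`, `bigRep`),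
`BigRepModuleShapiroInjectiveProofs.lean` (M1).
-/

noncomputable section

open Filter Topology Multiplicative
open Literature.NumberTheory.GaloisRepresentations

namespace Literature.NumberTheory.EllipticCurves.BigRepModule

universe u

variable {𝒪 : Type*} [CommRing 𝒪] {p : ℕ} [Fact p.Prime] {A : Type u} [AddCommGroup A] [Module 𝒪 A]
  [TopologicalSpace 𝒪] [TopologicalSpace A] [DiscreteTopology A]
  {G : Type u} [Group G] [TopologicalSpace G] [IsTopologicalGroup G]
  [TopologicalSpace (PowerSeries 𝒪)]
  {κ : G →ₜ* Multiplicative ℤ_[p]} {ρ : ContinuousRep G 𝒪 A} {σ : Multiplicative ℤ_[p] →ₜ* G}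

/-! ## §1 The argument `σ(x)⁻¹ g σ(x − κ g)` lies in `ker κ` and multiplies like a cocycle -/

omit [IsTopologicalGroup G] in
/-- The Shapiro argument lies in `ker κ`: `κ(σ(x)⁻¹ · g · σ(x − κ g)) = 1` for a section `σ` of `κ`.
[cite: SerreGaloisCohomology1997, I §2.5 (Shapiro's lemma)] -/
theorem kappa_shapiroArg (hσ : ∀ y, κ (σ y) = y) (g : G) (x : ℤ_[p]) :
    κ ((σ (ofAdd x))⁻¹ * g * σ (ofAdd (x - (κ g).toAdd))) = 1 := by
  rw [map_mul, map_mul, map_inv, hσ, hσ]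
  apply toAdd.injective
  rw [toAdd_mul, toAdd_mul, toAdd_inv, toAdd_ofAdd, toAdd_ofAdd, toAdd_one]
  abel

omit [IsTopologicalGroup G] in
/-- The Shapiro arguments multiply: `σ(x)⁻¹ (g h) σ(x − κ(gh)) = [σ(x)⁻¹ g σ(x − κ g)] · [σ(x − κ g)⁻¹ h σ((x − κ g) − κ h)]`.
[cite: SerreGaloisCohomology1997, I §2.5 (Shapiro's lemma)] -/
theorem shapiroArg_mul (g h : G) (x : ℤ_[p]) :
    (σ (ofAdd x))⁻¹ * (g * h) * σ (ofAdd (x - (κ (g * h)).toAdd)) =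
      ((σ (ofAdd x))⁻¹ * g * σ (ofAdd (x - (κ g).toAdd))) *
        ((σ (ofAdd (x - (κ g).toAdd)))⁻¹ * h * σ (ofAdd ((x - (κ g).toAdd) - (κ h).toAdd))) := by
  have hx : x - (κ (g * h)).toAdd = (x - (κ g).toAdd) - (κ h).toAdd := by
    rw [map_mul, toAdd_mul]; abel
  rw [hx]
  group

/-- **SHAPIRO SURJECTIVITY for the co-induced module, explicit form.** Let `G` be a topological group, `κ : G → ℤ_p` a continuous homomorphism with a continuous homomorphic SECTION `σ` (`κ (σ y) = y`),
`ρ` a continuous `𝒪`-linear representation of `G` on a discrete `p`-primary `A`, `H ≤ G` the kernel of `κ`,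
and `z : H → A` a continuous 1-cocycle of `ρ|_H` (`z(h₁h₂) = z(h₁) + ρ(h₁) z(h₂)`). Then there is a
continuous 1-cocycle `c : G → M = BigRepModule 𝒪 p A` of `bigRep κ ρ` (`c(gh) = c(g) + g·c(h)`) whose
Shapiro image is EXACTLY `z`: `c(h)(0) = z(h)` for all `h ∈ H`; namely
`c(g)(x) = ρ(σ x) z(σ(x)⁻¹ g σ(x − κ g))`. Hence (with M1) Shapiro's map `H¹(G, M) → H¹(H, A)` is onto.
[cite: SkinnerUrban2014, Prop. 3.2.3 (proof: "Appealing to Shapiro's lemma … `H¹(F_∞, T ⊗_A A^*) = … = H¹(F, T ⊗_A Λ^*_{F,A}(ε_F⁻¹))`")]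
[cite: SerreGaloisCohomology1997, I §2.5 (Shapiro's lemma)] -/
theorem exists_cocycle_apply_zero_eq (hσ : ∀ y, κ (σ y) = y) (hA : ∀ a : A, ∃ k : ℕ, p ^ k • a = 0)
    {H : Subgroup G} (hH : ∀ g : G, g ∈ H ↔ κ g = 1)
    (z : H → A) (hzc : Continuous z) (hz : ∀ h₁ h₂ : H, z (h₁ * h₂) = z h₁ + ρ (h₁ : G) (z h₂)) :
    ∃ c : G → BigRepModule 𝒪 p A, Continuous c ∧
      (∀ g h : G, c (g * h) = c g + bigRep κ ρ g (c h)) ∧ ∀ h : H, c (h : G) 0 = z h := by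
  classical
  -- the `H`-valued argument and the lift as a function of two variables
  have hmem : ∀ (g : G) (x : ℤ_[p]), (σ (ofAdd x))⁻¹ * g * σ (ofAdd (x - (κ g).toAdd)) ∈ H :=
    fun g x ↦ (hH _).2 (kappa_shapiroArg hσ g x)
  set u : G → ℤ_[p] → H := fun g x ↦ ⟨_, hmem g x⟩ with hu
  set F : G → ℤ_[p] → A := fun g x ↦ ρ (σ (ofAdd x)) (z (u g x)) with hF
  -- joint continuity of `(g, x) ↦ F g x`
  have hσc : Continuous fun x : ℤ_[p] ↦ σ (ofAdd x) := σ.continuous_toFun.comp continuous_ofAdd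
  have hκc : Continuous fun g : G ↦ (κ g).toAdd := continuous_toAdd.comp κ.continuous_toFun
  have huc : Continuous fun q : G × ℤ_[p] ↦ (u q.1 q.2 : H) := by
    refine Continuous.subtype_mk ?_ _
    exact ((hσc.comp continuous_snd).inv.mul continuous_fst).mul
      (hσc.comp (continuous_snd.sub (hκc.comp continuous_fst)))
  have hFc : Continuous fun q : G × ℤ_[p] ↦ F q.1 q.2 :=
    ρ.continuous_smul.comp ((hσc.comp continuous_snd).prodMk (hzc.comp huc))
  -- each slice `F g` is a member of `M`
  have hslice : ∀ g : G, Continuous (F g) := fun g ↦ hFc.comp (Continuous.prodMk_right g)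
  have hM : ∀ g : G, F g ∈ bigRepSubmodule 𝒪 p A := by
    intro g
    obtain ⟨n, hn⟩ := exists_isSmoothOfLevel_of_continuous (hslice g)
    have htor : ∀ x : ℤ_[p], ∃ k : ℕ, p ^ k • F g x = 0 := fun x ↦ by
      obtain ⟨k, hk⟩ := hA (z (u g x))
      exact ⟨k, by change p ^ k • ρ (σ (ofAdd x)) (z (u g x)) = 0; rw [← map_nsmul, hk, map_zero]⟩
    obtain ⟨k, hk⟩ := exists_uniform_pow_smul_eq_zero
      (((IsLocallyConstant.iff_continuous (F g)).2 (hslice g)).range_finite) htor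
    exact ⟨⟨n, hn⟩, ⟨k, hk⟩⟩
  refine ⟨fun g ↦ BigRepModule.mk (F g) (hM g), ?_, fun g h ↦ ?_, fun h ↦ ?_⟩
  · -- continuity into the DISCRETE module: the tube lemma over the compact `ℤ_p`
    refine (IsLocallyConstant.iff_continuous _).1 ((IsLocallyConstant.iff_eventually_eq _).2 fun g₀ ↦ ?_)
    have hpt : ∀ x ∈ (Set.univ : Set ℤ_[p]), ∀ᶠ q : G × ℤ_[p] in 𝓝 (g₀, x), F q.1 q.2 = F g₀ q.2 := by
      intro x _
      -- `F` is constant on a product neighbourhood `U × V` of `(g₀, x)`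
      have hev : ∀ᶠ q : G × ℤ_[p] in 𝓝 (g₀, x), F q.1 q.2 = F g₀ x :=
        ((IsLocallyConstant.iff_eventually_eq _).1
          ((IsLocallyConstant.iff_continuous _).2 hFc)) (g₀, x)
      rw [nhds_prod_eq] at hev ⊢
      obtain ⟨U, hU, V, hV, hUV⟩ := Filter.mem_prod_iff.1 hev
      refine Filter.mem_prod_iff.2 ⟨U, hU, V, hV, fun q hq ↦ ?_⟩
      have h1 : F q.1 q.2 = F g₀ x := hUV hq
      have h2 : F g₀ q.2 = F g₀ x := hUV (show (g₀, q.2) ∈ U ×ˢ V from ⟨mem_of_mem_nhds hU, hq.2⟩)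
      rw [Set.mem_setOf_eq, h1, h2]
    have htube : ∀ᶠ g in 𝓝 g₀, ∀ x ∈ (Set.univ : Set ℤ_[p]), F g x = F g₀ x :=
      (isCompact_univ (X := ℤ_[p])).eventually_forall_of_forall_eventually
        (x₀ := g₀) (P := fun g x ↦ F g x = F g₀ x) hpt
    filter_upwards [htube] with g hg
    exact BigRepModule.ext fun x ↦ by rw [BigRepModule.mk_apply, BigRepModule.mk_apply]; exact hg x (Set.mem_univ x)
  · -- the cocycle identity
    ext x
    rw [BigRepModule.mk_apply, BigRepModule.add_apply, bigRep_apply_apply, BigRepModule.mk_apply,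
      BigRepModule.mk_apply]
    change ρ (σ (ofAdd x)) (z (u (g * h) x)) =
      ρ (σ (ofAdd x)) (z (u g x)) + ρ g (ρ (σ (ofAdd (x - (κ g).toAdd))) (z (u h (x - (κ g).toAdd))))
    have hsplit : u (g * h) x = u g x * u h (x - (κ g).toAdd) := Subtype.ext (shapiroArg_mul g h x)
    have hprod : σ (ofAdd x) * ((u g x : H) : G) = g * σ (ofAdd (x - (κ g).toAdd)) := by
      change σ (ofAdd x) * ((σ (ofAdd x))⁻¹ * g * σ (ofAdd (x - (κ g).toAdd))) = _
      group
    rw [hsplit, hz, map_add, ← Module.End.mul_apply, ← map_mul, hprod, map_mul, Module.End.mul_apply]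
  · -- `c(h)(0) = z(h)`: `σ 0 = 1`
    rw [BigRepModule.mk_apply]
    change ρ (σ (ofAdd 0)) (z (u h 0)) = z h
    have h1 : σ (ofAdd (0 : ℤ_[p])) = 1 := by rw [ofAdd_zero, map_one]
    have hu0 : u h 0 = h := by
      refine Subtype.ext ?_
      change (σ (ofAdd 0))⁻¹ * (h : G) * σ (ofAdd (0 - (κ (h : G)).toAdd)) = h
      rw [(hH _).1 h.2, toAdd_one, sub_zero, h1, inv_one, one_mul, mul_one]
    rw [hu0, h1, map_one, Module.End.one_apply]

/-! ## §3 The same lift from a continuous section OF SETS (no homomorphy needed) -/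

/-- **SHAPIRO SURJECTIVITY for the co-induced module, explicit form.** Let `G` be a topological group, `κ : G → ℤ_p` a continuous homomorphism with a continuous homomorphic SECTION `σ` (`κ (σ y) = y`),
`ρ` a continuous `𝒪`-linear representation of `G` on a discrete `p`-primary `A`, `H ≤ G` the kernel of `κ`,
and `z : H → A` a continuous 1-cocycle of `ρ|_H` (`z(h₁h₂) = z(h₁) + ρ(h₁) z(h₂)`). Then there is a
continuous 1-cocycle `c : G → M = BigRepModule 𝒪 p A` of `bigRep κ ρ` (`c(gh) = c(g) + g·c(h)`) whose
Shapiro image is EXACTLY `z`: `c(h)(0) = z(h)` for all `h ∈ H`; namely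
`c(g)(x) = ρ(s x) z(s(x)⁻¹ g s(x − κ g))` — the homomorphy of the section is NOT used (the arguments
`s(x)⁻¹ g s(x − κ g)` still multiply like a cocycle). Hence (with M1) Shapiro's map is onto as soon as `κ`
has a continuous section of sets. [cite: SerreGaloisCohomology1997, I §1.2 Prop. 1 (continuous sections) and I §2.5]
[cite: SkinnerUrban2014, Prop. 3.2.3 (proof: "Appealing to Shapiro's lemma … `H¹(F_∞, T ⊗_A A^*) = … = H¹(F, T ⊗_A Λ^*_{F,A}(ε_F⁻¹))`")]
[cite: SerreGaloisCohomology1997, I §2.5 (Shapiro's lemma)] -/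
theorem exists_cocycle_apply_zero_eq_of_section {s : ℤ_[p] → G} (hsc : Continuous s)
    (hs : ∀ x, κ (s x) = ofAdd x) (hs0 : s 0 = 1) (hA : ∀ a : A, ∃ k : ℕ, p ^ k • a = 0)
    {H : Subgroup G} (hH : ∀ g : G, g ∈ H ↔ κ g = 1)
    (z : H → A) (hzc : Continuous z) (hz : ∀ h₁ h₂ : H, z (h₁ * h₂) = z h₁ + ρ (h₁ : G) (z h₂)) :
    ∃ c : G → BigRepModule 𝒪 p A, Continuous c ∧
      (∀ g h : G, c (g * h) = c g + bigRep κ ρ g (c h)) ∧ ∀ h : H, c (h : G) 0 = z h := by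
  classical
  -- the `H`-valued argument and the lift as a function of two variables
  have hmem : ∀ (g : G) (x : ℤ_[p]), (s x)⁻¹ * g * s (x - (κ g).toAdd) ∈ H :=
    fun g x ↦ (hH _).2 (by
      rw [map_mul, map_mul, map_inv, hs, hs]
      apply toAdd.injective
      rw [toAdd_mul, toAdd_mul, toAdd_inv, toAdd_ofAdd, toAdd_ofAdd, toAdd_one]
      abel)
  set u : G → ℤ_[p] → H := fun g x ↦ ⟨_, hmem g x⟩ with hu
  set F : G → ℤ_[p] → A := fun g x ↦ ρ (s x) (z (u g x)) with hF
  -- joint continuity of `(g, x) ↦ F g x`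
  have hsx : Continuous fun x : ℤ_[p] ↦ s x := hsc
  have hκc : Continuous fun g : G ↦ (κ g).toAdd := continuous_toAdd.comp κ.continuous_toFun
  have huc : Continuous fun q : G × ℤ_[p] ↦ (u q.1 q.2 : H) := by
    refine Continuous.subtype_mk ?_ _
    exact ((hsx.comp continuous_snd).inv.mul continuous_fst).mul
      (hsx.comp (continuous_snd.sub (hκc.comp continuous_fst)))
  have hFc : Continuous fun q : G × ℤ_[p] ↦ F q.1 q.2 :=
    ρ.continuous_smul.comp ((hsx.comp continuous_snd).prodMk (hzc.comp huc))
  -- each slice `F g` is a member of `M`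
  have hslice : ∀ g : G, Continuous (F g) := fun g ↦ hFc.comp (Continuous.prodMk_right g)
  have hM : ∀ g : G, F g ∈ bigRepSubmodule 𝒪 p A := by
    intro g
    obtain ⟨n, hn⟩ := exists_isSmoothOfLevel_of_continuous (hslice g)
    have htor : ∀ x : ℤ_[p], ∃ k : ℕ, p ^ k • F g x = 0 := fun x ↦ by
      obtain ⟨k, hk⟩ := hA (z (u g x))
      exact ⟨k, by change p ^ k • ρ (s x) (z (u g x)) = 0; rw [← map_nsmul, hk, map_zero]⟩
    obtain ⟨k, hk⟩ := exists_uniform_pow_smul_eq_zero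
      (((IsLocallyConstant.iff_continuous (F g)).2 (hslice g)).range_finite) htor
    exact ⟨⟨n, hn⟩, ⟨k, hk⟩⟩
  refine ⟨fun g ↦ BigRepModule.mk (F g) (hM g), ?_, fun g h ↦ ?_, fun h ↦ ?_⟩
  · -- continuity into the DISCRETE module: the tube lemma over the compact `ℤ_p`
    refine (IsLocallyConstant.iff_continuous _).1 ((IsLocallyConstant.iff_eventually_eq _).2 fun g₀ ↦ ?_)
    have hpt : ∀ x ∈ (Set.univ : Set ℤ_[p]), ∀ᶠ q : G × ℤ_[p] in 𝓝 (g₀, x), F q.1 q.2 = F g₀ q.2 := by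
      intro x _
      -- `F` is constant on a product neighbourhood `U × V` of `(g₀, x)`
      have hev : ∀ᶠ q : G × ℤ_[p] in 𝓝 (g₀, x), F q.1 q.2 = F g₀ x :=
        ((IsLocallyConstant.iff_eventually_eq _).1
          ((IsLocallyConstant.iff_continuous _).2 hFc)) (g₀, x)
      rw [nhds_prod_eq] at hev ⊢
      obtain ⟨U, hU, V, hV, hUV⟩ := Filter.mem_prod_iff.1 hev
      refine Filter.mem_prod_iff.2 ⟨U, hU, V, hV, fun q hq ↦ ?_⟩
      have h1 : F q.1 q.2 = F g₀ x := hUV hq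
      have h2 : F g₀ q.2 = F g₀ x := hUV (show (g₀, q.2) ∈ U ×ˢ V from ⟨mem_of_mem_nhds hU, hq.2⟩)
      rw [Set.mem_setOf_eq, h1, h2]
    have htube : ∀ᶠ g in 𝓝 g₀, ∀ x ∈ (Set.univ : Set ℤ_[p]), F g x = F g₀ x :=
      (isCompact_univ (X := ℤ_[p])).eventually_forall_of_forall_eventually
        (x₀ := g₀) (P := fun g x ↦ F g x = F g₀ x) hpt
    filter_upwards [htube] with g hg
    exact BigRepModule.ext fun x ↦ by rw [BigRepModule.mk_apply, BigRepModule.mk_apply]; exact hg x (Set.mem_univ x)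
  · -- the cocycle identity
    ext x
    rw [BigRepModule.mk_apply, BigRepModule.add_apply, bigRep_apply_apply, BigRepModule.mk_apply,
      BigRepModule.mk_apply]
    change ρ (s x) (z (u (g * h) x)) =
      ρ (s x) (z (u g x)) + ρ g (ρ (s (x - (κ g).toAdd)) (z (u h (x - (κ g).toAdd))))
    have hsplit : u (g * h) x = u g x * u h (x - (κ g).toAdd) := Subtype.ext (by
      change (s x)⁻¹ * (g * h) * s (x - (κ (g * h)).toAdd) =
        ((s x)⁻¹ * g * s (x - (κ g).toAdd)) * ((s (x - (κ g).toAdd))⁻¹ * h * s ((x - (κ g).toAdd) - (κ h).toAdd))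
      have hx : x - (κ (g * h)).toAdd = (x - (κ g).toAdd) - (κ h).toAdd := by
        rw [map_mul, toAdd_mul]; abel
      rw [hx]
      group)
    have hprod : s x * ((u g x : H) : G) = g * s (x - (κ g).toAdd) := by
      change s x * ((s x)⁻¹ * g * s (x - (κ g).toAdd)) = _
      group
    rw [hsplit, hz, map_add, ← Module.End.mul_apply, ← map_mul, hprod, map_mul, Module.End.mul_apply]
  · -- `c(h)(0) = z(h)`: `s 0 = 1`
    rw [BigRepModule.mk_apply]
    change ρ (s 0) (z (u h 0)) = z h
    have h1 : s (0 : ℤ_[p]) = 1 := hs0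
    have hu0 : u h 0 = h := by
      refine Subtype.ext ?_
      change (s 0)⁻¹ * (h : G) * s (0 - (κ (h : G)).toAdd) = h
      rw [(hH _).1 h.2, toAdd_one, sub_zero, h1, inv_one, one_mul, mul_one]
    rw [hu0, h1, map_one, Module.End.one_apply]

end Literature.NumberTheory.EllipticCurves.BigRepModule

end
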